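import Mathlib
import Summits.NavierStokesRegularity.NavierStokesRegularity.Theses.TrappingWindowRungThree
import Summits.NavierStokesRegularity.NavierStokesRegularity.Theorems.TrappingWindowRungThreeTailEnvelopesAhead
import Summits.NavierStokesRegularity.NavierStokesRegularity.Theorems.TrappingWindowRungThreeTailEnvelopesBehind
import Summits.NavierStokesRegularity.NavierStokesRegularity.Theorems.TrappingWindowRungThreeTailEnvelopesWindow
import HarnessLib

/-!
# `TrappingWindowRungThree.TailEnvelopes` (item stmt-NavierStokesRegularity-21748, crux K2 of routes
  TrappingWindowRungThree / ExactWindowRungThree / PicardRadiiRungThree)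

The ANALYTIC TAIL ENVELOPES of the finite-window trapping line at the comparable dyadic rung TL-M3 of
the Tao ladder (MODEL lattice ODEs only, scale ratio `2`): for every `R`-comparable Tao-topology table,
every window `[−Kb, Ka]` with positive sup bounds `M` and allowances `W` satisfying PC1–PC3 and the slack
condition WC, there is a margin `η₂ > 0` such that along every `(η, η)`-pseudo-flow (`0 < η ≤ η₂`) started
under the behind amplitude envelope `Cb 2^{(3/4)|k|}` (`k < −Kb`) and the ahead energy envelope
`Cg 2^{−7k}` (`k > Ka`), with slack under `η · slackWeight` of the epoch envelope, and whose window obeys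
`|S_k| ≤ M_k` on `[0, σ]` (`σ ≤ min(τ, c)`): on `[0, σ]` the boundary shells are STRICTLY admissible, the
window phantom stays STRICTLY below `η W`, the behind tail stays under `2^{1/4}` × envelope with energy
`≤ 2` × envelope², and the ahead energies stay `≤ 5 Cg 2^{−7k}`.

PROOF (assembled from the helper modules `…TailEnvelopesTools / Window / Ahead / BehindStep / Behind`):
restrict the flow to `[0, σ]` (`pseudoFlowOn_mono`) and take
`η₂ = min (2/(15c)) (1/ρ) (1/(5 c 4^{Ka}))` with the behind slack ratio
`ρ = (c M_{−Kb}² + (2c+1) W_{−Kb})/Cb² + 2c` (`slackWeight_behind_le`: `slackWeight L k ≤ ρ (Cb 2^{(3/4)|k|})²`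
behind the window, uniformly in `L`). BEHIND: `behind_tail_envelope` (amplitude bootstrap at `6/5`,
improved to `59/50 < 2^{1/4} < 6/5` by the shell-resolved size of the quadratic term + PC1 + the defect
budget `c η ≤ 2/15`). AHEAD: `ahead_tail_envelope` (energy bootstrap at `5`, improved to `99/20` by the
tail energy cap + the bond-flux budgets PC2/PC3; `½ S² ≤ (99/20) Cg 2^{−7(Ka+1)}` makes the top boundary
shell strictly admissible). WINDOW: `window_phantom_lt` (defect Grönwall + WC + `η c 4^k ≤ 1/5`).

HONEST FRAMING: an a priori estimate for Tao-type MODEL lattice pseudo-flows in the cell vocabulary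
(`PseudoFlowOn`, `slackWeight`, `InTableClass`); nothing here is a statement about the Navier–Stokes
equations; the route's leaf `TaoLadderRungThree.Target` (TL-M3) is not the summit Statement, the window
certificate K1 (`ExactFlowCertificate`, an instrument row) remains OPEN, and NS regularity is NOT proved by
anything in this file.
-/

noncomputable section

-- the sub-problem namespace repeats the summit name by design (D-0017)
set_option linter.dupNamespace false

namespace Summit.NavierStokesRegularity.NavierStokesRegularity.Theorems

open Set Filter Topology Literature.Analysis.FluidPDE Literature.Analysis.FluidPDE.TaoCascade
  GappedFrontRobust TailEnvelopes

/-- **Item stmt-NavierStokesRegularity-21748 (`TrappingWindowRungThree.TailEnvelopes`, crux K2).** The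
behind amplitude envelope `Cb 2^{(3/4)|k|}` and the ahead energy envelope `Cg 2^{−7k}` reproduce themselves
with margin along every `(η, η)`-pseudo-flow of an `R`-comparable table whose window obeys its sup bounds
up to the clock, and deliver strictly admissible boundary shells and a strict window phantom budget, for
all `η ≤ η₂(θ, c, Cb, Ka, M_{−Kb}, W_{−Kb})` — see the module docstring. MODEL lattice statement (rung
TL-M3); nothing about Navier–Stokes is concluded.
[cite: Tao2016AveragedNS, §4 Lemma 4.1 (4.5), (4.8)–(4.10) with (4.3); route TrappingWindowRungThree, item K2] -/
theorem trappingWindowRungThree_tailEnvelopes_proof :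
    Summit.NavierStokesRegularity.NavierStokesRegularity.Theses.TrappingWindowRungThree.TailEnvelopes := by
  unfold Summit.NavierStokesRegularity.NavierStokesRegularity.Theses.TrappingWindowRungThree.TailEnvelopes
  intro R θ c Cb Cg Kb Ka M W α hR hα hθ0 hθ hc hCb hCg hKb hKa hMW hPC1 hPC2 hPC3 hWC
  -- the table: |α| ≤ 1 on the shift set, cancelling
  have hcanc : IsCancellingCoeff α := hα.2.1
  have hα1 : ∀ (i₁ i₂ i₃ : Fin 4) (μ : ℤ × ℤ × ℤ), μ ∈ shiftSet → |α i₁ i₂ i₃ μ| ≤ 1 :=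
    fun i₁ i₂ i₃ μ hμ => (hα.2.2 i₁ i₂ i₃ μ hμ).1
  -- the epoch envelope of K1/K2
  set env : ℤ → ℝ := fun j : ℤ => if j < -Kb then 2 * (Cb * (2 : ℝ) ^ ((3 : ℝ) / 4 * (-(j : ℝ)))) ^ 2
    else if Ka < j then 5 * (Cg * (2 : ℝ) ^ (-(7 : ℝ) * (j : ℝ))) else (1 / 2) * M j ^ 2 + W j with henv
  have hMb : 0 < M (-Kb) := (hMW (-Kb) le_rfl (by omega)).1
  have hWb : 0 ≤ W (-Kb) := (hMW (-Kb) le_rfl (by omega)).2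
  -- the behind slack ratio and the margin
  set ρ : ℝ := (c * M (-Kb) ^ 2 + (2 * c + 1) * W (-Kb)) / Cb ^ 2 + 2 * c with hρ
  have hρpos : 0 < ρ := by
    have : 0 ≤ (c * M (-Kb) ^ 2 + (2 * c + 1) * W (-Kb)) / Cb ^ 2 := by positivity
    linarith
  have hq0 : 0 < (2 : ℝ) ^ ((2 : ℝ) * (Ka : ℝ)) := Real.rpow_pos_of_pos two_pos _
  refine ⟨min (min (2 / (15 * c)) (1 / ρ)) (1 / (5 * c * (2 : ℝ) ^ ((2 : ℝ) * (Ka : ℝ)))),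
    lt_min (lt_min (by positivity) (by positivity)) (by positivity), ?_⟩
  intro η σ τ L S₀ F₀ B₀ S F hη hηle hflow hS₀ hF₀ hB hσ hστ hσc hwin
  -- the margin's three budgets
  have hη1 : η ≤ 2 / (15 * c) := hηle.trans ((min_le_left _ _).trans (min_le_left _ _))
  have hη2 : η ≤ 1 / ρ := hηle.trans ((min_le_left _ _).trans (min_le_right _ _))
  have hη3 : η ≤ 1 / (5 * c * (2 : ℝ) ^ ((2 : ℝ) * (Ka : ℝ))) := hηle.trans (min_le_right _ _)
  have hηc : c * η ≤ 2 / 15 := by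
    calc c * η ≤ c * (2 / (15 * c)) := mul_le_mul_of_nonneg_left hη1 hc.le
      _ = 2 / 15 := by field_simp
  have hηρ : η * ρ ≤ 1 := (le_div_iff₀ hρpos).mp hη2
  have hη5 : η * c * (2 : ℝ) ^ ((2 : ℝ) * (Ka : ℝ)) ≤ 1 / 5 := by
    have h1 := (le_div_iff₀ (by positivity : (0 : ℝ) < 5 * c * (2 : ℝ) ^ ((2 : ℝ) * (Ka : ℝ)))).mp hη3
    linarith
  -- restrict the flow to [0, σ]
  have hflow' : PseudoFlowOn σ 1 α η η S₀ F₀ B₀ S F := pseudoFlowOn_mono hflow hσ hστ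
  -- BEHIND: the slack weight is under ρ · envelope², so the start slack is under the envelope²
  have henvnn : ∀ j, 0 ≤ env j := by
    intro j
    simp only [henv]
    split_ifs with h1 h2
    · positivity
    · positivity
    · have := (hMW j (by omega) (by omega)).2
      positivity
  have henv_b : ∀ j : ℤ, j < -Kb → env j = 2 * (Cb * (2 : ℝ) ^ ((3 : ℝ) / 4 * (-(j : ℝ)))) ^ 2 := by
    intro j hj
    simp only [henv, if_pos hj]
  have henv₀ : env (-Kb) = (1 / 2) * M (-Kb) ^ 2 + W (-Kb) := by
    simp only [henv, if_neg (lt_irrefl (-Kb)), if_neg (show ¬ Ka < -Kb by omega)]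
  have hWC' : ∀ L' : ℕ, 2 * slackWeight 1 θ c env L' (-Kb) ≤ W (-Kb) := by
    intro L'
    have h1 := hWC L' (-Kb) le_rfl (by omega)
    have h2 : 0 ≤ (c * (2 : ℝ) ^ ((2 : ℝ) * ((-Kb : ℤ) : ℝ)) + 1) * M (-Kb) ^ 2 := by positivity
    linarith
  have hsW := slackWeight_behind_le hθ hc.le hCb hKb hWb henvnn henv_b henv₀ hWC'
  have hB₀b : ∀ i k, k < -Kb → B₀ i k ≤ (Cb * (2 : ℝ) ^ ((3 : ℝ) / 4 * (-(k : ℝ)))) ^ 2 := by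
    intro i k hk
    have h1 := (hB i k).2
    have h2 := hsW L k hk
    have hA2 : 0 ≤ (Cb * (2 : ℝ) ^ ((3 : ℝ) / 4 * (-(k : ℝ)))) ^ 2 := sq_nonneg _
    calc B₀ i k ≤ η * slackWeight 1 θ c env L k := h1
      _ ≤ η * (ρ * (Cb * (2 : ℝ) ^ ((3 : ℝ) / 4 * (-(k : ℝ)))) ^ 2) := mul_le_mul_of_nonneg_left h2 hη.le
      _ = (η * ρ) * (Cb * (2 : ℝ) ^ ((3 : ℝ) / 4 * (-(k : ℝ)))) ^ 2 := by ring
      _ ≤ 1 * (Cb * (2 : ℝ) ^ ((3 : ℝ) / 4 * (-(k : ℝ)))) ^ 2 := mul_le_mul_of_nonneg_right hηρ hA2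
      _ = _ := one_mul _
  have hwinb : ∀ i, ∀ s ∈ Icc 0 σ, |S i (-Kb) s| ≤ M (-Kb) := fun i s hs => hwin i (-Kb) le_rfl (by omega) s hs
  have hBeh := behind_tail_envelope hflow' hσ hσc hη.le hα1 hCb hKb hPC1 hηc hS₀ hB₀b hwinb
  -- AHEAD
  have hwina : ∀ i, ∀ s ∈ Icc 0 σ, |S i Ka s| ≤ M Ka := fun i s hs => hwin i Ka (by omega) le_rfl s hs
  have hAh := ahead_tail_envelope hflow' hσ hσc hcanc hα1 hCg hPC2 hPC3 hF₀ hwina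
  have henva_pos : ∀ k : ℤ, 0 < Cg * (2 : ℝ) ^ (-(7 : ℝ) * (k : ℝ)) := fun k =>
    mul_pos hCg (Real.rpow_pos_of_pos two_pos _)
  have hFle : ∀ i k, ∀ s ∈ Icc 0 σ, F i k s ≤ ∑ j, F j k s := fun i k s hs =>
    Finset.single_le_sum (f := fun j => F j k s) (fun j _ => hflow'.nonneg_F j k s hs) (Finset.mem_univ i)
  refine ⟨?_, ?_, ?_, ?_, ?_⟩
  · -- C1: the bottom boundary shell is strictly admissible
    intro i s hs
    have h1 := (hBeh i (-Kb - 1) (by omega) s hs).1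
    have hcast : (3 : ℝ) / 4 * (-(((-Kb - 1 : ℤ)) : ℝ)) = (3 : ℝ) / 4 * ((Kb : ℝ) + 1) := by
      push_cast; ring
    rw [hcast] at h1
    have hpos : 0 < Cb * (2 : ℝ) ^ ((3 : ℝ) / 4 * ((Kb : ℝ) + 1)) := mul_pos hCb (Real.rpow_pos_of_pos two_pos _)
    linarith
  · -- C2: the top boundary shell is strictly admissible
    intro i s hs
    have h1 := hAh (Ka + 1) (by omega) s hs
    have h2 := hFle i (Ka + 1) s hs
    have h3 := hflow'.defect_lower i (Ka + 1) s hs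
    have hcast : (-(7 : ℝ) * (((Ka + 1 : ℤ)) : ℝ)) = -(7 : ℝ) * ((Ka : ℝ) + 1) := by push_cast; ring
    rw [hcast] at h1
    have hpos : 0 < Cg * (2 : ℝ) ^ (-(7 : ℝ) * ((Ka : ℝ) + 1)) := mul_pos hCg (Real.rpow_pos_of_pos two_pos _)
    refine Real.lt_sqrt (abs_nonneg _) |>.mpr ?_
    rw [sq_abs]
    linarith
  · -- C3: the window phantom budget
    intro i k hk1 hk2 s hs
    have hsmall : η * c * (2 : ℝ) ^ ((2 : ℝ) * (k : ℝ)) ≤ 1 / 5 := by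
      have hmono := two_rpow_two_mul_mono hk2
      have : η * c * (2 : ℝ) ^ ((2 : ℝ) * (k : ℝ)) ≤ η * c * (2 : ℝ) ^ ((2 : ℝ) * (Ka : ℝ)) :=
        mul_le_mul_of_nonneg_left hmono (by positivity)
      linarith
    exact window_phantom_lt hflow' hσ hσc hη i k (hMW k hk1 hk2).1 (hWC L k hk1 hk2) (hB i k)
      (hwin i k hk1 hk2) hsmall s hs
  · -- C4: the behind tail
    intro i k hk s hs
    obtain ⟨h1, h2⟩ := hBeh i k hk s hs
    have hA0 : 0 ≤ Cb * (2 : ℝ) ^ ((3 : ℝ) / 4 * (-(k : ℝ))) := (mul_pos hCb (Real.rpow_pos_of_pos two_pos _)).le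
    exact ⟨h1.trans (mul_le_mul_of_nonneg_right lt_two_rpow_quarter.le hA0), h2⟩
  · -- C5: the ahead tail energies
    intro i k hk s hs
    have h1 := hAh k hk s hs
    have := henva_pos k
    linarith [hFle i k s hs]

end Summit.NavierStokesRegularity.NavierStokesRegularity.Theorems

end
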